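import Literature.NumberTheory.Sieve.IwaniecAlmostPrimesPairCrude
import Literature.NumberTheory.Sieve.IwaniecAlmostPrimesProofs
import HarnessLib

/-!
# Iwaniec (1978), §4: Proposition 1 — PROVED

H. Iwaniec, *Almost-primes represented by quadratic polynomials*, Invent. Math. 47 (1978)
171–188, Proposition 1 (p. 176) and its proof (§4, pp. 181–185).

**Proposition 1.** For `ε > 0`, `1 ≤ M < x`, `N ≥ 1` and `|b_n| ≤ 1` supported on squarefree `n`,
`∑_{M<m<2M} |∑_{n<N, (n,m)=1} b_n r(𝒜; mn)|² ≪ {1 + N^{7/2} M^{−5/4} x} x^{1+ε}`.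

This file assembles the proof from the series `IwaniecAlmostPrimes{RhoMeanValue, RootExpSum,
Lemma4, Dispersion, LinearModel, WCount, VW, PairSums, PairBound, PairCrude}`:
* `∑_m B(m)² ≤ (max_m ρ(m)) · 𝒟`, `𝒟 = ∑_{n₁,n₂} b_{n₁} b_{n₂} T(n₁,n₂)` (Cauchy–Schwarz over the
  roots `v mod m`, `sum_sq_bilinearB_le`, `dispersion_eq_sum_sum`);
* `|T(n₁,n₂)| ≤ C J³ (1 + log 16x)² (x (n₁,n₂)/(n₁n₂) + x² M^{−5/4+η/2} K^{3/2+η} (n₁,n₂))`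
  (`abs_tsum2_le_crude`: the evaluations of `W, V, U` by the corrected Lemma 4 — through Lemma 6,
  Hooley's bound `lemma6_hooley`, proved in `IwaniecAlmostPrimesProofs` — and the cancellation of
  the main terms), summed over the pairs with `∑∑ (n₁,n₂)/(n₁n₂) ≤ (1+log K)³`,
  `∑∑ (n₁,n₂) ≤ K²(1+log K)` (`sum_sq_bilinearB_le_dispersion`);
* the trivial estimate `|B(x; m, N)| ≤ ρ(m) ∑_{n<N} ρ(n)` in the ranges `M < 2` and `N > x^{1/6}`
  (`sum_sq_bilinearB_le_trivial`), and the bookkeeping of the `x^{O(η)}` factors with `η = ε/40`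
  (`proposition1_of_lemma6`, `proposition1_holds`).
-/

noncomputable section

open Finset Real

namespace Literature.NumberTheory.Sieve.Iwaniec1978

/-! ### The `m`-range of Proposition 1 -/

/-- `{1 ≤ m ≤ ⌈2M⌉ : M < m < 2M} = (⌊M⌋, ⌈2M⌉ − 1]`. [folklore] -/
theorem filter_Icc_eq_Ioc {M : ℝ} (hM : 0 ≤ M) :
    (Finset.Icc 1 ⌈2 * M⌉₊).filter (fun m : ℕ => M < m ∧ (m : ℝ) < 2 * M) =
      Finset.Ioc ⌊M⌋₊ (⌈2 * M⌉₊ - 1) := by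
  ext m
  simp only [Finset.mem_filter, Finset.mem_Icc, Finset.mem_Ioc]
  constructor
  · rintro ⟨⟨-, -⟩, h3, h4⟩
    refine ⟨(Nat.floor_lt hM).mpr h3, ?_⟩
    have : m < ⌈2 * M⌉₊ := Nat.lt_ceil.mpr h4
    omega
  · rintro ⟨h1, h2⟩
    have h3 : M < m := (Nat.floor_lt hM).mp h1
    have h4 : m < ⌈2 * M⌉₊ := by omega
    exact ⟨⟨by omega, by omega⟩, h3, Nat.lt_ceil.mp h4⟩

/-! ### The dispersion bound (`2 ≤ M ≤ x`) -/

/-- Sums of nonnegative terms over `[1, K)²` are at most the sums over `[1, K]²`. [folklore] -/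
theorem sum_Ico_sum_Ico_le_Icc {F : ℕ → ℕ → ℝ} (hF : ∀ a b, 0 ≤ F a b) (K : ℕ) :
    ∑ a ∈ Finset.Ico 1 K, ∑ b ∈ Finset.Ico 1 K, F a b ≤
      ∑ a ∈ Finset.Icc 1 K, ∑ b ∈ Finset.Icc 1 K, F a b := by
  have hsub : Finset.Ico 1 K ⊆ Finset.Icc 1 K := fun n hn => by
    rw [Finset.mem_Ico] at hn; rw [Finset.mem_Icc]; omega
  calc ∑ a ∈ Finset.Ico 1 K, ∑ b ∈ Finset.Ico 1 K, F a b
      ≤ ∑ a ∈ Finset.Ico 1 K, ∑ b ∈ Finset.Icc 1 K, F a b :=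
        Finset.sum_le_sum fun a _ =>
          Finset.sum_le_sum_of_subset_of_nonneg hsub fun b _ _ => hF a b
    _ ≤ ∑ a ∈ Finset.Icc 1 K, ∑ b ∈ Finset.Icc 1 K, F a b :=
        Finset.sum_le_sum_of_subset_of_nonneg hsub fun a _ _ =>
          Finset.sum_nonneg fun b _ => hF a b

set_option maxHeartbeats 800000 in
/-- **`∑_{M<m<2M} B(m)² ≪` the dispersion bound** (pp. 181–185): for `0 < η ≤ 1/2` there is `C`
with, for `2 ≤ M ≤ x`, `N ≥ 1`, `|b| ≤ 1` supported on squarefrees, `K = ⌈N⌉`,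
`∑_{M<m<2M} B(m)² ≤ C M^η (K^{4η})³ (1+log 16x)² (1+log K)³ (x + x² M^{−5/4+η/2} K^{7/2+η})`.
[cite: IwaniecInventiones1978, §4 pp. 181–185] -/
theorem sum_sq_bilinearB_le_dispersion (h6 : lemma6_hooley) {η : ℝ} (hη : 0 < η)
    (hη2 : η ≤ 1 / 2) :
    ∃ C : ℝ, 0 ≤ C ∧ ∀ (x M N : ℝ) (b : ℕ → ℝ), 2 ≤ M → M ≤ x → 1 ≤ N →
      (∀ n, |b n| ≤ 1) → (∀ n, ¬ Squarefree n → b n = 0) →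
      ∑ m ∈ (Finset.Icc 1 ⌈2 * M⌉₊).filter (fun m : ℕ => M < m ∧ (m : ℝ) < 2 * M),
          bilinearB x b m N ^ 2 ≤
        C * M ^ η * ((((⌈N⌉₊ : ℕ) : ℝ) ^ 4) ^ η) ^ 3 * (1 + Real.log (16 * x)) ^ 2 *
          (1 + Real.log ((⌈N⌉₊ : ℕ) : ℝ)) ^ 3 *
          (x + x ^ 2 * M ^ (-(5 / 4 : ℝ) + η / 2) * (((⌈N⌉₊ : ℕ) : ℝ)) ^ (7 / 2 + η : ℝ)) := by
  obtain ⟨C, hC0, hC⟩ := abs_tsum2_le_crude h6 hη hη2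
  obtain ⟨Cτ, hCτ1, hτ⟩ := Literature.NumberTheory.Sieve.exists_card_divisors_le_mul_rpow hη
  refine ⟨2 * Cτ * C, by positivity, ?_⟩
  intro x M N b hM hMx hN hb hbsf
  have hM0 : 0 < M := by linarith
  have hM1 : 1 ≤ M := by linarith
  have hx0 : 0 ≤ x := by linarith
  rw [filter_Icc_eq_Ioc hM0.le]
  obtain ⟨-, -, -, hB2M, -, -, -, -⟩ := params_real hM
  set K : ℕ := ⌈N⌉₊ with hK
  set S := Finset.Ioc ⌊M⌋₊ (⌈2 * M⌉₊ - 1) with hS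
  have hK1 : 1 ≤ K := by rw [hK]; exact Nat.one_le_ceil_iff.mpr (by linarith)
  have hK0r : (0 : ℝ) < K := by exact_mod_cast hK1
  have hK1r : (1 : ℝ) ≤ K := by exact_mod_cast hK1
  have hSpos : ∀ m ∈ S, 0 < m := by
    intro m hm; rw [hS, Finset.mem_Ioc] at hm; omega
  have hT : ∀ m ∈ S, (rho m : ℝ) ≤ 2 * Cτ * M ^ η := by
    intro m hm
    rw [hS, Finset.mem_Ioc] at hm
    have hm0 : m ≠ 0 := by omega
    have hm2M : (m : ℝ) ≤ 2 * M := by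
      have : ((m : ℕ) : ℝ) ≤ ((⌈2 * M⌉₊ - 1 : ℕ) : ℝ) := by exact_mod_cast hm.2
      linarith
    have h2η : (2 : ℝ) ^ η ≤ 2 := by
      calc (2 : ℝ) ^ η ≤ 2 ^ (1 : ℝ) := Real.rpow_le_rpow_of_exponent_le (by norm_num) (by linarith)
        _ = 2 := Real.rpow_one 2
    calc (rho m : ℝ) ≤ m.divisors.card := by exact_mod_cast rho_le_card_divisors m
      _ ≤ Cτ * (m : ℝ) ^ η := hτ m hm0
      _ ≤ Cτ * (2 * M) ^ η :=
          mul_le_mul_of_nonneg_left (Real.rpow_le_rpow (Nat.cast_nonneg _) hm2M hη.le) (by linarith)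
      _ = Cτ * (2 ^ η * M ^ η) := by rw [Real.mul_rpow (by norm_num) hM0.le]
      _ ≤ Cτ * (2 * M ^ η) := by
          apply mul_le_mul_of_nonneg_left _ (by linarith)
          exact mul_le_mul_of_nonneg_right h2η (Real.rpow_nonneg hM0.le _)
      _ = 2 * Cτ * M ^ η := by ring
  have h1 := sum_sq_bilinearB_le x b N hSpos hT
  rw [dispersion_eq_sum_sum x b N S, ← hK] at h1
  -- the bound for one pair (zero unless both are squarefree)
  have hpair : ∀ n₁ ∈ Finset.Ico 1 K, ∀ n₂ ∈ Finset.Ico 1 K,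
      b n₁ * b n₂ * tsum2 x S n₁ n₂ ≤
        C * (((K : ℝ) ^ 4) ^ η) ^ 3 * (1 + Real.log (16 * x)) ^ 2 *
          (x * (Nat.gcd n₁ n₂ : ℝ) / ((n₁ : ℝ) * n₂) +
            x ^ 2 * M ^ (-(5 / 4 : ℝ) + η / 2) * (K : ℝ) ^ (3 / 2 + η : ℝ) * Nat.gcd n₁ n₂) := by
    intro n₁ hn₁ n₂ hn₂
    have hBnd0 : 0 ≤ C * (((K : ℝ) ^ 4) ^ η) ^ 3 * (1 + Real.log (16 * x)) ^ 2 *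
        (x * (Nat.gcd n₁ n₂ : ℝ) / ((n₁ : ℝ) * n₂) +
          x ^ 2 * M ^ (-(5 / 4 : ℝ) + η / 2) * (K : ℝ) ^ (3 / 2 + η : ℝ) * Nat.gcd n₁ n₂) := by
      positivity
    by_cases hs : Squarefree n₁ ∧ Squarefree n₂
    · have h := hC x M K n₁ n₂ hM hMx hn₁ hn₂ hs.1 hs.2
      rw [← hS] at h
      have hb12 : |b n₁ * b n₂| ≤ 1 := by
        rw [abs_mul]
        calc |b n₁| * |b n₂| ≤ 1 * 1 := mul_le_mul (hb n₁) (hb n₂) (abs_nonneg _) zero_le_one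
          _ = 1 := one_mul 1
      calc b n₁ * b n₂ * tsum2 x S n₁ n₂ ≤ |b n₁ * b n₂ * tsum2 x S n₁ n₂| := le_abs_self _
        _ = |b n₁ * b n₂| * |tsum2 x S n₁ n₂| := abs_mul _ _
        _ ≤ 1 * (C * (((K : ℝ) ^ 4) ^ η) ^ 3 * (1 + Real.log (16 * x)) ^ 2 *
            (x * (Nat.gcd n₁ n₂ : ℝ) / ((n₁ : ℝ) * n₂) +
              x ^ 2 * M ^ (-(5 / 4 : ℝ) + η / 2) * (K : ℝ) ^ (3 / 2 + η : ℝ) * Nat.gcd n₁ n₂)) :=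
            mul_le_mul hb12 h (abs_nonneg _) zero_le_one
        _ = _ := one_mul _
    · have h0 : b n₁ * b n₂ = 0 := by
        rw [not_and_or] at hs
        rcases hs with hs | hs
        · rw [hbsf n₁ hs, zero_mul]
        · rw [hbsf n₂ hs, mul_zero]
      rw [h0, zero_mul]; exact hBnd0
  -- sum over the pairs
  have hA : ∑ n₁ ∈ Finset.Ico 1 K, ∑ n₂ ∈ Finset.Ico 1 K, (Nat.gcd n₁ n₂ : ℝ) / ((n₁ : ℝ) * n₂) ≤
      (1 + Real.log K) ^ 3 :=
    (sum_Ico_sum_Ico_le_Icc (fun a b => by positivity) K).trans (sum_sum_gcd_div_le K)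
  have hB : ∑ n₁ ∈ Finset.Ico 1 K, ∑ n₂ ∈ Finset.Ico 1 K, (Nat.gcd n₁ n₂ : ℝ) ≤
      (K : ℝ) ^ 2 * (1 + Real.log K) :=
    (sum_Ico_sum_Ico_le_Icc (fun a b => by positivity) K).trans (sum_sum_gcd_le K)
  set c : ℝ := C * (((K : ℝ) ^ 4) ^ η) ^ 3 * (1 + Real.log (16 * x)) ^ 2 with hc
  set Z' : ℝ := x ^ 2 * M ^ (-(5 / 4 : ℝ) + η / 2) * (K : ℝ) ^ (3 / 2 + η : ℝ) with hZ'
  have hc0 : 0 ≤ c := by rw [hc]; positivity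
  have hZ'0 : 0 ≤ Z' := by rw [hZ']; positivity
  have h2 : ∑ n₁ ∈ Finset.Ico 1 K, ∑ n₂ ∈ Finset.Ico 1 K, b n₁ * b n₂ * tsum2 x S n₁ n₂ ≤
      c * (x * (1 + Real.log K) ^ 3 + Z' * ((K : ℝ) ^ 2 * (1 + Real.log K))) := by
    have hsplit : ∀ n₁ n₂ : ℕ, c * (x * (Nat.gcd n₁ n₂ : ℝ) / ((n₁ : ℝ) * n₂) + Z' * Nat.gcd n₁ n₂) =
        c * x * ((Nat.gcd n₁ n₂ : ℝ) / ((n₁ : ℝ) * n₂)) + c * Z' * (Nat.gcd n₁ n₂ : ℝ) :=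
      fun _ _ => by ring
    calc _ ≤ ∑ n₁ ∈ Finset.Ico 1 K, ∑ n₂ ∈ Finset.Ico 1 K,
          c * (x * (Nat.gcd n₁ n₂ : ℝ) / ((n₁ : ℝ) * n₂) + Z' * Nat.gcd n₁ n₂) :=
          Finset.sum_le_sum fun n₁ hn₁ => Finset.sum_le_sum fun n₂ hn₂ => hpair n₁ hn₁ n₂ hn₂
      _ = c * x * (∑ n₁ ∈ Finset.Ico 1 K, ∑ n₂ ∈ Finset.Ico 1 K,
              (Nat.gcd n₁ n₂ : ℝ) / ((n₁ : ℝ) * n₂)) +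
            c * Z' * (∑ n₁ ∈ Finset.Ico 1 K, ∑ n₂ ∈ Finset.Ico 1 K, (Nat.gcd n₁ n₂ : ℝ)) := by
          simp_rw [hsplit, Finset.sum_add_distrib, ← Finset.mul_sum]
      _ ≤ c * x * (1 + Real.log K) ^ 3 + c * Z' * ((K : ℝ) ^ 2 * (1 + Real.log K)) :=
          add_le_add (mul_le_mul_of_nonneg_left hA (by positivity))
            (mul_le_mul_of_nonneg_left hB (by positivity))
      _ = _ := by ring
  -- final shape
  have hL1 : 1 ≤ 1 + Real.log K := by
    have : 0 ≤ Real.log K := Real.log_nonneg hK1r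
    linarith
  have hL3 : 1 + Real.log K ≤ (1 + Real.log K) ^ 3 := le_self_pow₀ hL1 (by norm_num)
  have hKpow : (K : ℝ) ^ (3 / 2 + η : ℝ) * (K : ℝ) ^ 2 = (K : ℝ) ^ (7 / 2 + η : ℝ) := by
    rw [← Real.rpow_two, ← Real.rpow_add hK0r]; congr 1; ring
  have hT0 : 0 ≤ 2 * Cτ * M ^ η := by positivity
  have hD : ∑ m ∈ S, ∑ v ∈ rootsNat m, evm x b N m v ^ 2 ≤
      c * (1 + Real.log K) ^ 3 * (x + Z' * (K : ℝ) ^ 2) := by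
    rw [dispersion_eq_sum_sum x b N S, ← hK]
    refine h2.trans ?_
    have h3 : Z' * ((K : ℝ) ^ 2 * (1 + Real.log K)) ≤ Z' * (K : ℝ) ^ 2 * (1 + Real.log K) ^ 3 := by
      rw [← mul_assoc]
      exact mul_le_mul_of_nonneg_left hL3 (by positivity)
    have h4 : c * (x * (1 + Real.log K) ^ 3 + Z' * ((K : ℝ) ^ 2 * (1 + Real.log K))) ≤
        c * (x * (1 + Real.log K) ^ 3 + Z' * (K : ℝ) ^ 2 * (1 + Real.log K) ^ 3) :=
      mul_le_mul_of_nonneg_left (by linarith) hc0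
    refine h4.trans (le_of_eq ?_)
    ring
  calc ∑ m ∈ S, bilinearB x b m N ^ 2 ≤ (2 * Cτ * M ^ η) * ∑ m ∈ S, ∑ v ∈ rootsNat m, evm x b N m v ^ 2 :=
        sum_sq_bilinearB_le x b N hSpos hT
    _ ≤ (2 * Cτ * M ^ η) * (c * (1 + Real.log K) ^ 3 * (x + Z' * (K : ℝ) ^ 2)) :=
        mul_le_mul_of_nonneg_left hD hT0
    _ = _ := by rw [hc, hZ', mul_assoc (x ^ 2 * M ^ (-(5 / 4 : ℝ) + η / 2)), hKpow]; ring

/-! ### The trivial bound -/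

/-- **The trivial estimate** (p. 176, "If `M < x^{14/15−ε}` the result follows from the trivial
estimate `|B(x; m, N)| ≤ ρ(m) ∑_{n<N} ρ(n) ≪ ρ(m) N`"): for `0 < η ≤ 1` there is `C` with
`∑_{M<m<2M} B(m)² ≤ C N² M^{1+η}` for `1 ≤ M ≤ x`, `N ≥ 1`, `|b| ≤ 1`.
[cite: IwaniecInventiones1978, §4 p. 176] -/
theorem sum_sq_bilinearB_le_trivial {η : ℝ} (hη : 0 < η) (hη1 : η ≤ 1) :
    ∃ C : ℝ, 0 ≤ C ∧ ∀ (x M N : ℝ) (b : ℕ → ℝ), 1 ≤ M → M ≤ x → 1 ≤ N → (∀ n, |b n| ≤ 1) →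
      ∑ m ∈ (Finset.Icc 1 ⌈2 * M⌉₊).filter (fun m : ℕ => M < m ∧ (m : ℝ) < 2 * M),
          bilinearB x b m N ^ 2 ≤ C * N ^ 2 * M ^ (1 + η) := by
  obtain ⟨Cτ, hCτ1, hτ⟩ := Literature.NumberTheory.Sieve.exists_card_divisors_le_mul_rpow hη
  obtain ⟨Cρ, hCρ0, hSumRho⟩ := exists_sum_rho_le
  refine ⟨36 * Cρ ^ 3 * Cτ, by positivity, ?_⟩
  intro x M N b hM hMx hN hb
  have hM0 : 0 < M := by linarith
  have hx0 : 0 ≤ x := by linarith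
  set R := (Finset.Icc 1 ⌈2 * M⌉₊).filter (fun m : ℕ => M < m ∧ (m : ℝ) < 2 * M) with hR
  -- `∑_{n<N} ρ(n) ≤ 2 C_ρ N`
  set SN : ℝ := ∑ n ∈ Finset.Ico 1 ⌈N⌉₊, (rho n : ℝ) with hSN
  have hSN0 : 0 ≤ SN := Finset.sum_nonneg fun _ _ => Nat.cast_nonneg _
  have hSNle : SN ≤ 2 * Cρ * N := by
    have h1 : SN ≤ ∑ n ∈ Finset.Icc 1 ⌊max N 2⌋₊, (rho n : ℝ) :=
      Finset.sum_le_sum_of_subset_of_nonneg (Ico_one_ceil_subset N) fun _ _ _ => Nat.cast_nonneg _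
    have h2 := hSumRho (max N 2) (le_max_right _ _)
    have h3 : max N 2 ≤ 2 * N := max_le (by linarith) (by linarith)
    calc SN ≤ Cρ * max N 2 := h1.trans h2
      _ ≤ Cρ * (2 * N) := mul_le_mul_of_nonneg_left h3 hCρ0.le
      _ = 2 * Cρ * N := by ring
  -- `ρ(m) ≤ 3 C_τ M^η` on the block and `∑_{m ≤ ⌈2M⌉} ρ(m) ≤ 3 C_ρ M`
  have hmax : ∀ m ∈ R, (rho m : ℝ) ≤ 3 * Cτ * M ^ η := by
    intro m hm
    rw [hR, Finset.mem_filter, Finset.mem_Icc] at hm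
    have hm0 : m ≠ 0 := by omega
    have hm3M : (m : ℝ) ≤ 3 * M := by linarith [hm.2.2]
    have h3η : (3 : ℝ) ^ η ≤ 3 := by
      calc (3 : ℝ) ^ η ≤ 3 ^ (1 : ℝ) := Real.rpow_le_rpow_of_exponent_le (by norm_num) hη1
        _ = 3 := Real.rpow_one 3
    calc (rho m : ℝ) ≤ m.divisors.card := by exact_mod_cast rho_le_card_divisors m
      _ ≤ Cτ * (m : ℝ) ^ η := hτ m hm0
      _ ≤ Cτ * (3 * M) ^ η :=
          mul_le_mul_of_nonneg_left (Real.rpow_le_rpow (Nat.cast_nonneg _) hm3M hη.le) (by linarith)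
      _ = Cτ * (3 ^ η * M ^ η) := by rw [Real.mul_rpow (by norm_num) hM0.le]
      _ ≤ Cτ * (3 * M ^ η) := by
          apply mul_le_mul_of_nonneg_left _ (by linarith)
          exact mul_le_mul_of_nonneg_right h3η (Real.rpow_nonneg hM0.le _)
      _ = 3 * Cτ * M ^ η := by ring
  have hsumρ : ∑ m ∈ R, (rho m : ℝ) ≤ 3 * Cρ * M := by
    have hsub : R ⊆ Finset.Icc 1 ⌊2 * M + 1⌋₊ := by
      intro m hm
      rw [hR, Finset.mem_filter, Finset.mem_Icc] at hm
      rw [Finset.mem_Icc]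
      refine ⟨hm.1.1, Nat.le_floor ?_⟩
      linarith [hm.2.2]
    have h2 := hSumRho (2 * M + 1) (by linarith)
    calc ∑ m ∈ R, (rho m : ℝ) ≤ ∑ m ∈ Finset.Icc 1 ⌊2 * M + 1⌋₊, (rho m : ℝ) :=
          Finset.sum_le_sum_of_subset_of_nonneg hsub fun _ _ _ => Nat.cast_nonneg _
      _ ≤ Cρ * (2 * M + 1) := h2
      _ ≤ Cρ * (3 * M) := mul_le_mul_of_nonneg_left (by linarith) hCρ0.le
      _ = 3 * Cρ * M := by ring
  -- per `m`
  have hper : ∀ m ∈ R, bilinearB x b m N ^ 2 ≤ (2 * Cρ * N) ^ 2 * (3 * Cτ * M ^ η) * rho m := by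
    intro m hm
    have hm' := hm
    rw [hR, Finset.mem_filter, Finset.mem_Icc] at hm'
    have hm0 : m ≠ 0 := by omega
    have h1 : |bilinearB x b m N| ≤ (rho m : ℝ) * SN := abs_bilinearB_le hx0 hb hm0 N
    have hρ0 : (0 : ℝ) ≤ rho m := Nat.cast_nonneg _
    calc bilinearB x b m N ^ 2 = |bilinearB x b m N| ^ 2 := (sq_abs _).symm
      _ ≤ ((rho m : ℝ) * SN) ^ 2 := pow_le_pow_left₀ (abs_nonneg _) h1 2
      _ = SN ^ 2 * rho m * rho m := by ring
      _ ≤ (2 * Cρ * N) ^ 2 * (3 * Cτ * M ^ η) * rho m := by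
          apply mul_le_mul_of_nonneg_right _ hρ0
          exact mul_le_mul (pow_le_pow_left₀ hSN0 hSNle 2) (hmax m hm) hρ0 (by positivity)
  have hpow : M ^ η * M = M ^ (1 + η) := by
    rw [add_comm, Real.rpow_add_one hM0.ne']
  calc ∑ m ∈ R, bilinearB x b m N ^ 2 ≤ ∑ m ∈ R, (2 * Cρ * N) ^ 2 * (3 * Cτ * M ^ η) * rho m :=
        Finset.sum_le_sum hper
    _ = (2 * Cρ * N) ^ 2 * (3 * Cτ * M ^ η) * ∑ m ∈ R, (rho m : ℝ) := by rw [Finset.mul_sum]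
    _ ≤ (2 * Cρ * N) ^ 2 * (3 * Cτ * M ^ η) * (3 * Cρ * M) :=
        mul_le_mul_of_nonneg_left hsumρ (by positivity)
    _ = 36 * Cρ ^ 3 * Cτ * N ^ 2 * (M ^ η * M) := by ring
    _ = _ := by rw [hpow]

/-! ### Bookkeeping of the `x^{O(η)}` factors -/

/-- `1 + log y ≤ (1 + 1/η) y^η` for `y ≥ 1`, `η > 0`. [folklore] -/
theorem one_add_log_le {y η : ℝ} (hy : 1 ≤ y) (hη : 0 < η) :
    1 + Real.log y ≤ (1 + 1 / η) * y ^ η := by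
  have h1 : Real.log y ≤ y ^ η / η := Real.log_le_rpow_div (by linarith) hη
  have h2 : 1 ≤ y ^ η := Real.one_le_rpow hy hη.le
  have : (1 + 1 / η) * y ^ η = y ^ η + y ^ η / η := by ring
  rw [this]; linarith

/-- The dispersion range: the `x^{O(η)}` factors are absorbed into `x^ε` (`40η ≤ ε`).
[cite: IwaniecInventiones1978, §4 p. 185] -/
theorem caseB_junk {ε η x M N : ℝ} {K : ℕ} (hη : 0 < η) (hη2 : η ≤ 1 / 2) (hηε : 40 * η ≤ ε)
    (hx : 1 ≤ x) (hM0 : 0 < M) (hMx : M ≤ x) (hN : 1 ≤ N) (hNx : N ≤ x)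
    (hK1 : 1 ≤ (K : ℝ)) (hK : (K : ℝ) ≤ 2 * N) :
    M ^ η * (((K : ℝ) ^ 4) ^ η) ^ 3 * (1 + Real.log (16 * x)) ^ 2 *
        (1 + Real.log ((K : ℕ) : ℝ)) ^ 3 *
        (x + x ^ 2 * M ^ (-(5 / 4 : ℝ) + η / 2) * (K : ℝ) ^ (7 / 2 + η : ℝ)) ≤
      2 ^ 27 * (1 + 1 / η) ^ 5 * ((1 + N ^ (7 / 2 : ℝ) * M ^ (-(5 / 4 : ℝ)) * x) * x ^ (1 + ε)) := by
  have hη1 : η ≤ 1 := by linarith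
  have hx0 : 0 < x := by linarith
  have hN0 : 0 < N := by linarith
  have hK0 : (0 : ℝ) ≤ K := by linarith
  set y : ℝ := x ^ η with hy
  set A : ℝ := 1 + 1 / η with hA
  have hy1 : 1 ≤ y := Real.one_le_rpow hx hη.le
  have hy0 : 0 ≤ y := by linarith
  have hηinv : 0 < 1 / η := by positivity
  have hA1 : 1 ≤ A := by rw [hA]; linarith
  have hK2x : (K : ℝ) ≤ 2 * x := by linarith
  -- (1) `M^η ≤ y`
  have h1 : M ^ η ≤ y := Real.rpow_le_rpow hM0.le hMx hη.le
  -- (2) `((K^4)^η)^3 ≤ 4096 y^12`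
  have h2a : ((K : ℝ) ^ 4) ^ η ≤ 16 * y ^ 4 := by
    have hx4 : (x ^ 4) ^ η = y ^ 4 := by
      rw [hy, ← Real.rpow_natCast_mul hx0.le, ← Real.rpow_mul_natCast hx0.le]; norm_num; ring_nf
    have h16 : (16 : ℝ) ^ η ≤ 16 := by
      calc (16 : ℝ) ^ η ≤ 16 ^ (1 : ℝ) := Real.rpow_le_rpow_of_exponent_le (by norm_num) hη1
        _ = 16 := Real.rpow_one 16
    calc ((K : ℝ) ^ 4) ^ η ≤ ((2 * x) ^ 4) ^ η :=
          Real.rpow_le_rpow (by positivity) (pow_le_pow_left₀ hK0 hK2x 4) hη.le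
      _ = (16 * x ^ 4) ^ η := by ring_nf
      _ = 16 ^ η * (x ^ 4) ^ η := Real.mul_rpow (by norm_num) (by positivity)
      _ ≤ 16 * y ^ 4 := by
          rw [hx4]; exact mul_le_mul_of_nonneg_right h16 (by positivity)
  have h2 : (((K : ℝ) ^ 4) ^ η) ^ 3 ≤ 4096 * y ^ 12 := by
    calc (((K : ℝ) ^ 4) ^ η) ^ 3 ≤ (16 * y ^ 4) ^ 3 :=
          pow_le_pow_left₀ (Real.rpow_nonneg (by positivity) _) h2a 3
      _ = 4096 * y ^ 12 := by ring
  -- (3) `(1 + log 16x)^2 ≤ 256 A^2 y^2`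
  have h3a : 1 + Real.log (16 * x) ≤ 16 * A * y := by
    have h16 : (16 : ℝ) ^ η ≤ 16 := by
      calc (16 : ℝ) ^ η ≤ 16 ^ (1 : ℝ) := Real.rpow_le_rpow_of_exponent_le (by norm_num) hη1
        _ = 16 := Real.rpow_one 16
    calc 1 + Real.log (16 * x) ≤ A * (16 * x) ^ η := by rw [hA]; exact one_add_log_le (by linarith) hη
      _ = A * (16 ^ η * y) := by rw [Real.mul_rpow (by norm_num) hx0.le]
      _ ≤ A * (16 * y) := by
          apply mul_le_mul_of_nonneg_left _ (by linarith)
          exact mul_le_mul_of_nonneg_right h16 hy0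
      _ = 16 * A * y := by ring
  have hl0 : 0 ≤ 1 + Real.log (16 * x) := by
    have : 0 ≤ Real.log (16 * x) := Real.log_nonneg (by linarith); linarith
  have h3 : (1 + Real.log (16 * x)) ^ 2 ≤ 256 * A ^ 2 * y ^ 2 := by
    calc (1 + Real.log (16 * x)) ^ 2 ≤ (16 * A * y) ^ 2 := pow_le_pow_left₀ hl0 h3a 2
      _ = 256 * A ^ 2 * y ^ 2 := by ring
  -- (4) `(1 + log K)^3 ≤ 8 A^3 y^3`
  have h4a : 1 + Real.log ((K : ℕ) : ℝ) ≤ 2 * A * y := by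
    have h2η : (2 : ℝ) ^ η ≤ 2 := by
      calc (2 : ℝ) ^ η ≤ 2 ^ (1 : ℝ) := Real.rpow_le_rpow_of_exponent_le (by norm_num) hη1
        _ = 2 := Real.rpow_one 2
    have hlogK : Real.log ((K : ℕ) : ℝ) ≤ Real.log (2 * x) := Real.log_le_log (by linarith) hK2x
    calc 1 + Real.log ((K : ℕ) : ℝ) ≤ 1 + Real.log (2 * x) := by linarith
      _ ≤ A * (2 * x) ^ η := by rw [hA]; exact one_add_log_le (by linarith) hη
      _ = A * (2 ^ η * y) := by rw [Real.mul_rpow (by norm_num) hx0.le]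
      _ ≤ A * (2 * y) := by
          apply mul_le_mul_of_nonneg_left _ (by linarith)
          exact mul_le_mul_of_nonneg_right h2η hy0
      _ = 2 * A * y := by ring
  have hlK0 : 0 ≤ 1 + Real.log ((K : ℕ) : ℝ) := by
    have : 0 ≤ Real.log ((K : ℕ) : ℝ) := Real.log_nonneg hK1; linarith
  have h4 : (1 + Real.log ((K : ℕ) : ℝ)) ^ 3 ≤ 8 * A ^ 3 * y ^ 3 := by
    calc (1 + Real.log ((K : ℕ) : ℝ)) ^ 3 ≤ (2 * A * y) ^ 3 := pow_le_pow_left₀ hlK0 h4a 3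
      _ = 8 * A ^ 3 * y ^ 3 := by ring
  -- (5) `x² M^{−5/4+η/2} K^{7/2+η} ≤ 16 x² N^{7/2} M^{−5/4} y²`
  have h5 : x ^ 2 * M ^ (-(5 / 4 : ℝ) + η / 2) * (K : ℝ) ^ (7 / 2 + η : ℝ) ≤
      16 * x ^ 2 * N ^ (7 / 2 : ℝ) * M ^ (-(5 / 4 : ℝ)) * y ^ 2 := by
    have hM1 : M ^ (-(5 / 4 : ℝ) + η / 2) = M ^ (-(5 / 4 : ℝ)) * M ^ (η / 2) :=
      Real.rpow_add hM0 _ _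
    have hMη : M ^ (η / 2) ≤ y := by
      calc M ^ (η / 2) ≤ x ^ (η / 2) := Real.rpow_le_rpow hM0.le hMx (by linarith)
        _ ≤ x ^ η := Real.rpow_le_rpow_of_exponent_le hx (by linarith)
    have hKp : (K : ℝ) ^ (7 / 2 + η : ℝ) ≤ 16 * N ^ (7 / 2 : ℝ) * y := by
      have h2p : (2 : ℝ) ^ (7 / 2 + η : ℝ) ≤ 16 := by
        calc (2 : ℝ) ^ (7 / 2 + η : ℝ) ≤ 2 ^ ((4 : ℕ) : ℝ) :=
            Real.rpow_le_rpow_of_exponent_le (by norm_num) (by norm_num; linarith)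
          _ = 16 := by rw [Real.rpow_natCast]; norm_num
      have hNη : N ^ η ≤ y := Real.rpow_le_rpow hN0.le hNx hη.le
      have hN72 : 0 ≤ N ^ (7 / 2 : ℝ) := Real.rpow_nonneg hN0.le _
      calc (K : ℝ) ^ (7 / 2 + η : ℝ) ≤ (2 * N) ^ (7 / 2 + η : ℝ) :=
            Real.rpow_le_rpow hK0 hK (by linarith)
        _ = 2 ^ (7 / 2 + η : ℝ) * (N ^ (7 / 2 : ℝ) * N ^ η) := by
            rw [Real.mul_rpow (by norm_num) hN0.le, Real.rpow_add hN0]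
        _ ≤ 16 * (N ^ (7 / 2 : ℝ) * y) :=
            mul_le_mul h2p (mul_le_mul_of_nonneg_left hNη hN72) (by positivity) (by norm_num)
        _ = 16 * N ^ (7 / 2 : ℝ) * y := by ring
    have hM54 : 0 ≤ M ^ (-(5 / 4 : ℝ)) := Real.rpow_nonneg hM0.le _
    rw [hM1]
    calc x ^ 2 * (M ^ (-(5 / 4 : ℝ)) * M ^ (η / 2)) * (K : ℝ) ^ (7 / 2 + η : ℝ)
        ≤ x ^ 2 * (M ^ (-(5 / 4 : ℝ)) * y) * (16 * N ^ (7 / 2 : ℝ) * y) := by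
          apply mul_le_mul (mul_le_mul_of_nonneg_left (mul_le_mul_of_nonneg_left hMη hM54)
            (by positivity)) hKp (Real.rpow_nonneg hK0 _) (by positivity)
      _ = 16 * x ^ 2 * N ^ (7 / 2 : ℝ) * M ^ (-(5 / 4 : ℝ)) * y ^ 2 := by ring
  -- (6) `y^20 ≤ x^ε`, `x^ε · x = x^{1+ε}`
  have h6 : y ^ 20 ≤ x ^ ε := by
    rw [hy, ← Real.rpow_mul_natCast hx0.le]
    exact Real.rpow_le_rpow_of_exponent_le hx (by push_cast; linarith)
  have h6' : y ^ 18 ≤ y ^ 20 := pow_le_pow_right₀ hy1 (by norm_num)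
  have h7 : x ^ ε * x = x ^ (1 + ε) := by rw [add_comm, Real.rpow_add_one hx0.ne']
  -- assemble
  have hJ : M ^ η * (((K : ℝ) ^ 4) ^ η) ^ 3 * (1 + Real.log (16 * x)) ^ 2 *
      (1 + Real.log ((K : ℕ) : ℝ)) ^ 3 ≤ 2 ^ 23 * A ^ 5 * y ^ 18 := by
    calc _ ≤ y * (4096 * y ^ 12) * (256 * A ^ 2 * y ^ 2) * (8 * A ^ 3 * y ^ 3) :=
          mul_le_mul (mul_le_mul (mul_le_mul h1 h2 (by positivity) hy0) h3 (sq_nonneg _)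
            (by positivity)) h4 (by positivity) (by positivity)
      _ = 2 ^ 23 * A ^ 5 * y ^ 18 := by ring
  have hX : x + x ^ 2 * M ^ (-(5 / 4 : ℝ) + η / 2) * (K : ℝ) ^ (7 / 2 + η : ℝ) ≤
      x + 16 * x ^ 2 * N ^ (7 / 2 : ℝ) * M ^ (-(5 / 4 : ℝ)) * y ^ 2 := by linarith
  have hX0 : 0 ≤ x + x ^ 2 * M ^ (-(5 / 4 : ℝ) + η / 2) * (K : ℝ) ^ (7 / 2 + η : ℝ) := by
    positivity
  have hNM : 0 ≤ N ^ (7 / 2 : ℝ) * M ^ (-(5 / 4 : ℝ)) := by positivity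
  calc _ ≤ (2 ^ 23 * A ^ 5 * y ^ 18) * (x + 16 * x ^ 2 * N ^ (7 / 2 : ℝ) * M ^ (-(5 / 4 : ℝ)) * y ^ 2) :=
        mul_le_mul hJ hX hX0 (by positivity)
    _ = 2 ^ 23 * A ^ 5 * (x * y ^ 18 + 16 * x ^ 2 * (N ^ (7 / 2 : ℝ) * M ^ (-(5 / 4 : ℝ))) * y ^ 20) := by
        ring
    _ ≤ 2 ^ 23 * A ^ 5 * (x * x ^ ε + 16 * x ^ 2 * (N ^ (7 / 2 : ℝ) * M ^ (-(5 / 4 : ℝ))) * x ^ ε) := by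
        apply mul_le_mul_of_nonneg_left _ (by positivity)
        apply add_le_add (mul_le_mul_of_nonneg_left (h6'.trans h6) hx0.le)
        exact mul_le_mul_of_nonneg_left h6 (by positivity)
    _ = 2 ^ 23 * A ^ 5 * ((1 + 16 * (N ^ (7 / 2 : ℝ) * M ^ (-(5 / 4 : ℝ)) * x)) * x ^ (1 + ε)) := by
        rw [← h7]; ring
    _ ≤ 2 ^ 23 * A ^ 5 * ((16 * (1 + N ^ (7 / 2 : ℝ) * M ^ (-(5 / 4 : ℝ)) * x)) * x ^ (1 + ε)) := by
        apply mul_le_mul_of_nonneg_left _ (by positivity)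
        apply mul_le_mul_of_nonneg_right _ (by positivity)
        nlinarith
    _ = 2 ^ 27 * (1 + 1 / η) ^ 5 * ((1 + N ^ (7 / 2 : ℝ) * M ^ (-(5 / 4 : ℝ)) * x) * x ^ (1 + ε)) := by
        rw [hA]; ring

/-- The trivial ranges `M < 2` or `N > x^{1/6}`: `N² M^{1+η} ≤ 16 (1 + N^{7/2} M^{−5/4} x) x^{1+ε}`
(`η ≤ ε`). [cite: IwaniecInventiones1978, §4 p. 176] -/
theorem caseA_bound {ε η x M N : ℝ} (hη : 0 < η) (hη1 : η ≤ 1) (hηε : η ≤ ε) (hx : 1 ≤ x)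
    (hM1 : 1 ≤ M) (hMx : M ≤ x) (hN : 1 ≤ N) (h : M < 2 ∨ x ^ (1 / 6 : ℝ) < N) :
    N ^ 2 * M ^ (1 + η) ≤ 16 * ((1 + N ^ (7 / 2 : ℝ) * M ^ (-(5 / 4 : ℝ)) * x) * x ^ (1 + ε)) := by
  have hx0 : 0 < x := by linarith
  have hM0 : 0 < M := by linarith
  have hN0 : 0 < N := by linarith
  have hxe1 : 1 ≤ x ^ (1 + ε) := Real.one_le_rpow hx (by linarith)
  have hN72 : N ^ 2 ≤ N ^ (7 / 2 : ℝ) := by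
    rw [← Real.rpow_two]
    exact Real.rpow_le_rpow_of_exponent_le hN (by norm_num)
  have hM54 : 0 < M ^ (-(5 / 4 : ℝ)) := Real.rpow_pos_of_pos hM0 _
  rcases h with hM2 | hNx
  · -- `M < 2`
    have hMpow : M ^ (1 + η) ≤ 4 := by
      calc M ^ (1 + η) ≤ (2 : ℝ) ^ (1 + η) := Real.rpow_le_rpow hM0.le hM2.le (by linarith)
        _ ≤ (2 : ℝ) ^ ((2 : ℕ) : ℝ) := Real.rpow_le_rpow_of_exponent_le (by norm_num) (by norm_num; linarith)
        _ = 4 := by rw [Real.rpow_natCast]; norm_num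
    have hMinv : 1 / 4 ≤ M ^ (-(5 / 4 : ℝ)) := by
      calc (1 / 4 : ℝ) = (2 : ℝ) ^ (-(2 : ℝ)) := by
            rw [Real.rpow_neg (by norm_num), Real.rpow_two]; norm_num
        _ ≤ (2 : ℝ) ^ (-(5 / 4 : ℝ)) := Real.rpow_le_rpow_of_exponent_le (by norm_num) (by norm_num)
        _ ≤ M ^ (-(5 / 4 : ℝ)) := Real.rpow_le_rpow_of_nonpos hM0 hM2.le (by norm_num)
    have hN2 : 0 ≤ N ^ 2 := sq_nonneg _
    calc N ^ 2 * M ^ (1 + η) ≤ N ^ (7 / 2 : ℝ) * 4 := mul_le_mul hN72 hMpow (by positivity) (by positivity)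
      _ = N ^ (7 / 2 : ℝ) * (1 / 4) * 1 * 1 * 16 := by ring
      _ ≤ N ^ (7 / 2 : ℝ) * M ^ (-(5 / 4 : ℝ)) * x * x ^ (1 + ε) * 16 := by
          apply mul_le_mul_of_nonneg_right _ (by norm_num)
          exact mul_le_mul (mul_le_mul (mul_le_mul_of_nonneg_left hMinv (by positivity)) hx
            zero_le_one (by positivity)) hxe1 zero_le_one (by positivity)
      _ ≤ 16 * ((1 + N ^ (7 / 2 : ℝ) * M ^ (-(5 / 4 : ℝ)) * x) * x ^ (1 + ε)) := by
          have : 0 ≤ x ^ (1 + ε) := by positivity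
          nlinarith
  · -- `x^{1/6} < N`
    have h14 : x ^ (1 / 4 : ℝ) ≤ N ^ (3 / 2 : ℝ) := by
      have : (x ^ (1 / 6 : ℝ)) ^ (3 / 2 : ℝ) ≤ N ^ (3 / 2 : ℝ) :=
        Real.rpow_le_rpow (by positivity) hNx.le (by norm_num)
      rw [← Real.rpow_mul hx0.le] at this
      norm_num at this
      exact this
    have hsplit : M ^ (1 + η) = M ^ (-(5 / 4 : ℝ)) * M ^ (9 / 4 + η : ℝ) := by
      rw [← Real.rpow_add hM0]; congr 1; ring
    have hM94 : M ^ (9 / 4 + η : ℝ) ≤ x ^ (9 / 4 + η : ℝ) := Real.rpow_le_rpow hM0.le hMx (by linarith)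
    have hx94 : x ^ (9 / 4 + η : ℝ) = x ^ (1 / 4 : ℝ) * x ^ (2 + η : ℝ) := by
      rw [← Real.rpow_add hx0]; congr 1; ring
    have hx2η : x ^ (2 + η : ℝ) ≤ x * x ^ (1 + ε) := by
      calc x ^ (2 + η : ℝ) ≤ x ^ (2 + ε : ℝ) := Real.rpow_le_rpow_of_exponent_le hx (by linarith)
        _ = x ^ (1 : ℝ) * x ^ (1 + ε) := by rw [← Real.rpow_add hx0]; congr 1; ring
        _ = x * x ^ (1 + ε) := by rw [Real.rpow_one]
    have hN72' : N ^ 2 * N ^ (3 / 2 : ℝ) = N ^ (7 / 2 : ℝ) := by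
      rw [← Real.rpow_two, ← Real.rpow_add hN0]; congr 1; norm_num
    calc N ^ 2 * M ^ (1 + η) = N ^ 2 * (M ^ (-(5 / 4 : ℝ)) * M ^ (9 / 4 + η : ℝ)) := by rw [hsplit]
      _ ≤ N ^ 2 * (M ^ (-(5 / 4 : ℝ)) * (x ^ (1 / 4 : ℝ) * x ^ (2 + η : ℝ))) := by
          rw [← hx94]
          exact mul_le_mul_of_nonneg_left (mul_le_mul_of_nonneg_left hM94 hM54.le) (sq_nonneg _)
      _ ≤ N ^ 2 * (M ^ (-(5 / 4 : ℝ)) * (N ^ (3 / 2 : ℝ) * (x * x ^ (1 + ε)))) := by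
          apply mul_le_mul_of_nonneg_left _ (sq_nonneg _)
          apply mul_le_mul_of_nonneg_left _ hM54.le
          exact mul_le_mul h14 hx2η (by positivity) (by positivity)
      _ = (N ^ 2 * N ^ (3 / 2 : ℝ)) * M ^ (-(5 / 4 : ℝ)) * x * x ^ (1 + ε) := by ring
      _ = N ^ (7 / 2 : ℝ) * M ^ (-(5 / 4 : ℝ)) * x * x ^ (1 + ε) := by rw [hN72']
      _ ≤ 16 * ((1 + N ^ (7 / 2 : ℝ) * M ^ (-(5 / 4 : ℝ)) * x) * x ^ (1 + ε)) := by
          have h0 : 0 ≤ N ^ (7 / 2 : ℝ) * M ^ (-(5 / 4 : ℝ)) * x * x ^ (1 + ε) := by positivity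
          have h1 : 0 ≤ x ^ (1 + ε) := by positivity
          nlinarith

/-! ### Proposition 1 -/

/-- **Proposition 1 from Lemma 6** (the whole of §4, pp. 176–185): Hooley's Weil-type bound for
the incomplete Kloosterman-type sums over the roots of `ν² + 1 ≡ 0` (Lemma 6) implies the
dispersion estimate of Proposition 1. [cite: IwaniecInventiones1978, Proposition 1 p. 176] -/
theorem proposition1_of_lemma6 (h6 : lemma6_hooley) : proposition1 := by
  intro ε hε
  set η : ℝ := min (ε / 40) (1 / 2) with hη
  have hη0 : 0 < η := lt_min (by linarith) (by norm_num)
  have hη2 : η ≤ 1 / 2 := min_le_right _ _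
  have hη40 : 40 * η ≤ ε := by have := min_le_left (ε / 40) (1 / 2); linarith
  have hη1 : η ≤ 1 := by linarith
  have hηε : η ≤ ε := by linarith
  obtain ⟨CB, hCB0, hCB⟩ := sum_sq_bilinearB_le_dispersion h6 hη0 hη2
  obtain ⟨CT, hCT0, hCT⟩ := sum_sq_bilinearB_le_trivial hη0 hη1
  refine ⟨CB * (2 ^ 27 * (1 + 1 / η) ^ 5) + 16 * CT, ?_⟩
  intro x M N b hM hMx hN hb hbsf
  have hx1 : 1 ≤ x := by linarith
  have hM0 : 0 < M := by linarith
  have hN0 : 0 ≤ N := by linarith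
  have hR0 : 0 ≤ (1 + N ^ (7 / 2 : ℝ) * M ^ (-(5 / 4 : ℝ)) * x) * x ^ (1 + ε) := by positivity
  have hkey : (CB * (2 ^ 27 * (1 + 1 / η) ^ 5) + 16 * CT) * (1 + N ^ (7 / 2 : ℝ) * M ^ (-(5 / 4 : ℝ)) * x) *
      x ^ (1 + ε) =
      CB * (2 ^ 27 * (1 + 1 / η) ^ 5 * ((1 + N ^ (7 / 2 : ℝ) * M ^ (-(5 / 4 : ℝ)) * x) * x ^ (1 + ε))) +
        CT * (16 * ((1 + N ^ (7 / 2 : ℝ) * M ^ (-(5 / 4 : ℝ)) * x) * x ^ (1 + ε))) := by ring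
  have hB0 : 0 ≤ CB * (2 ^ 27 * (1 + 1 / η) ^ 5 *
      ((1 + N ^ (7 / 2 : ℝ) * M ^ (-(5 / 4 : ℝ)) * x) * x ^ (1 + ε))) := by positivity
  have hT0 : 0 ≤ CT * (16 * ((1 + N ^ (7 / 2 : ℝ) * M ^ (-(5 / 4 : ℝ)) * x) * x ^ (1 + ε))) := by
    positivity
  rw [hkey]
  by_cases hcase : 2 ≤ M ∧ N ≤ x ^ (1 / 6 : ℝ)
  · obtain ⟨hM2, hNx6⟩ := hcase
    have hNx : N ≤ x := hNx6.trans (by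
      calc x ^ (1 / 6 : ℝ) ≤ x ^ (1 : ℝ) := Real.rpow_le_rpow_of_exponent_le hx1 (by norm_num)
        _ = x := Real.rpow_one x)
    have hK1 : (1 : ℝ) ≤ ((⌈N⌉₊ : ℕ) : ℝ) := by
      exact_mod_cast Nat.one_le_ceil_iff.mpr (by linarith : (0 : ℝ) < N)
    have hK2 : ((⌈N⌉₊ : ℕ) : ℝ) ≤ 2 * N := by
      have := Nat.ceil_lt_add_one hN0; linarith
    have h := hCB x M N b hM2 hMx.le hN hb hbsf
    have hj := caseB_junk (ε := ε) hη0 hη2 hη40 hx1 hM0 hMx.le hN hNx hK1 hK2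
    calc _ ≤ _ := h
      _ = CB * (M ^ η * ((((⌈N⌉₊ : ℕ) : ℝ) ^ 4) ^ η) ^ 3 * (1 + Real.log (16 * x)) ^ 2 *
          (1 + Real.log ((⌈N⌉₊ : ℕ) : ℝ)) ^ 3 *
          (x + x ^ 2 * M ^ (-(5 / 4 : ℝ) + η / 2) * (((⌈N⌉₊ : ℕ) : ℝ)) ^ (7 / 2 + η : ℝ))) := by
          ring
      _ ≤ CB * (2 ^ 27 * (1 + 1 / η) ^ 5 *
          ((1 + N ^ (7 / 2 : ℝ) * M ^ (-(5 / 4 : ℝ)) * x) * x ^ (1 + ε))) :=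
          mul_le_mul_of_nonneg_left hj hCB0
      _ ≤ _ := le_add_of_nonneg_right hT0
  · have h := hCT x M N b hM hMx.le hN hb
    rw [not_and_or, not_le, not_le] at hcase
    have hj := caseA_bound (ε := ε) hη0 hη1 hηε hx1 hM hMx.le hN hcase
    calc _ ≤ CT * N ^ 2 * M ^ (1 + η) := h
      _ = CT * (N ^ 2 * M ^ (1 + η)) := by ring
      _ ≤ CT * (16 * ((1 + N ^ (7 / 2 : ℝ) * M ^ (-(5 / 4 : ℝ)) * x) * x ^ (1 + ε))) :=
          mul_le_mul_of_nonneg_left hj hCT0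
      _ ≤ _ := le_add_of_nonneg_left hB0

/-- **Proposition 1 of Iwaniec (1978), proved**: the named fact `proposition1` of
`IwaniecAlmostPrimes.lean` holds (Lemma 6 is the tree's proved `lemma6_hooley_holds`, resting on
the Weil bound for Kloosterman sums to prime moduli of `KloostermanWeilPrimeProofs`).
[cite: IwaniecInventiones1978, Proposition 1 p. 176] -/
theorem proposition1_holds : proposition1 := proposition1_of_lemma6 lemma6_hooley_holds

end Literature.NumberTheory.Sieve.Iwaniec1978

end
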